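import Mathlib.MeasureTheory.Measure.Decomposition.RadonNikodym
import Mathlib.MeasureTheory.Measure.Prod
import Mathlib.Probability.Independence.Basic
import HarnessLib

/-!
# Route `ColdStartUniversality`, crux K_A1 (stmt-QuantumFields-24809), `L²` twin of line «cold_entropy»: `1 + χ²` IS MULTIPLICATIVE
# OVER INDEPENDENT MODES — `∫ (d(ν₁⊗ν₂)/d(μ₁⊗μ₂))² d(μ₁⊗μ₂) = ∫ (dν₁/dμ₁)² dμ₁ · ∫ (dν₂/dμ₂)² dμ₂`

Helper file (seat `ym-line-csu-p1`, g16; `--supports stmt-QuantumFields-24809`).  The bookkeeping behind the free-field heuristic for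
hypothesis (H2) of `chiSquareStep` (K-uniform cold-start χ² budget): for product (independent-mode) laws the quantity `1 + χ² = ∫ h² dμ`
multiplies, so `log(1 + χ²_total) = Σ_k log(1 + χ²_k) ≤ Σ_k χ²_k`, and the per-mode bound `ouModeChiSquare` (`χ²_k ≲ e^{−4κ_k s₀}/2`)
makes the sum a Weyl-law sum, uniform in the momentum box (`stub_weylEntropySum`, landed) — exactly as for the entropy budget
(`KL` is additive over independent modes).

* `rnDeriv_prod_ae_eq` — `d(ν₁⊗ν₂)/d(μ₁⊗μ₂) = (dν₁/dμ₁) ⊗ (dν₂/dμ₂)` a.e. (`ν_i ≪ μ_i`, finite measures);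
* ★ `lintegral_rnDeriv_sq_prod` — `∫⁻ (d(ν₁⊗ν₂)/d(μ₁⊗μ₂))² d(μ₁⊗μ₂) = (∫⁻ (dν₁/dμ₁)² dμ₁) · (∫⁻ (dν₂/dμ₂)² dμ₂)`.

THEOREMS ONLY, no definition, no sorry; abstract measure theory.  HONEST FRAMING: bookkeeping; nothing about Yang–Mills is proved here;
the Yang–Mills mass gap is NOT proved.
-/

set_option autoImplicit false

noncomputable section

namespace Summit.QuantumFields.YangMills.Theorems.ColdStartUniversality

open MeasureTheory
open scoped ENNReal

variable {α β : Type*} [MeasurableSpace α] [MeasurableSpace β]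

/-- **The density of a product is the product of the densities**: for finite measures with `ν₁ ≪ μ₁`, `ν₂ ≪ μ₂`,
`d(ν₁⊗ν₂)/d(μ₁⊗μ₂) (x,y) = (dν₁/dμ₁)(x) · (dν₂/dμ₂)(y)` for `μ₁⊗μ₂`-a.e. `(x,y)`. [folklore] -/
theorem rnDeriv_prod_ae_eq (ν₁ μ₁ : Measure α) (ν₂ μ₂ : Measure β) [IsFiniteMeasure ν₁] [IsFiniteMeasure μ₁]
    [IsFiniteMeasure ν₂] [IsFiniteMeasure μ₂] (h₁ : ν₁ ≪ μ₁) (h₂ : ν₂ ≪ μ₂) :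
    (ν₁.prod ν₂).rnDeriv (μ₁.prod μ₂) =ᵐ[μ₁.prod μ₂] fun p => ν₁.rnDeriv μ₁ p.1 * ν₂.rnDeriv μ₂ p.2 := by
  have e₁ : ν₁ = μ₁.withDensity (ν₁.rnDeriv μ₁) := (Measure.withDensity_rnDeriv_eq _ _ h₁).symm
  have e₂ : ν₂ = μ₂.withDensity (ν₂.rnDeriv μ₂) := (Measure.withDensity_rnDeriv_eq _ _ h₂).symm
  have hprod : ν₁.prod ν₂ = (μ₁.prod μ₂).withDensity (fun p => ν₁.rnDeriv μ₁ p.1 * ν₂.rnDeriv μ₂ p.2) := by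
    conv_lhs => rw [e₁, e₂]
    exact prod_withDensity (Measure.measurable_rnDeriv _ _) (Measure.measurable_rnDeriv _ _)
  rw [hprod]
  exact Measure.rnDeriv_withDensity _
    (((Measure.measurable_rnDeriv _ _).comp measurable_fst).mul ((Measure.measurable_rnDeriv _ _).comp measurable_snd))

/-- ★ **`1 + χ²` is multiplicative over independent factors**: for finite measures with `ν_i ≪ μ_i`,
`∫⁻ (d(ν₁⊗ν₂)/d(μ₁⊗μ₂))² d(μ₁⊗μ₂) = (∫⁻ (dν₁/dμ₁)² dμ₁)(∫⁻ (dν₂/dμ₂)² dμ₂)` (for probability measures `∫ h² dμ = 1 + χ²`).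
[folklore] -/
theorem lintegral_rnDeriv_sq_prod (ν₁ μ₁ : Measure α) (ν₂ μ₂ : Measure β) [IsFiniteMeasure ν₁] [IsFiniteMeasure μ₁]
    [IsFiniteMeasure ν₂] [IsFiniteMeasure μ₂] (h₁ : ν₁ ≪ μ₁) (h₂ : ν₂ ≪ μ₂) :
    ∫⁻ p, ((ν₁.prod ν₂).rnDeriv (μ₁.prod μ₂) p) ^ 2 ∂(μ₁.prod μ₂) =
      (∫⁻ x, (ν₁.rnDeriv μ₁ x) ^ 2 ∂μ₁) * ∫⁻ y, (ν₂.rnDeriv μ₂ y) ^ 2 ∂μ₂ := by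
  have hae := rnDeriv_prod_ae_eq ν₁ μ₁ ν₂ μ₂ h₁ h₂
  rw [lintegral_congr_ae (hae.mono fun p hp => by rw [hp])]
  simp_rw [mul_pow]
  exact lintegral_prod_mul ((Measure.measurable_rnDeriv _ _).pow_const 2).aemeasurable
    ((Measure.measurable_rnDeriv _ _).pow_const 2).aemeasurable

end Summit.QuantumFields.YangMills.Theorems.ColdStartUniversality

end
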